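import Literature.NumberTheory.Automorphic.ParallelWeightTensorEmbedding
import Literature.NumberTheory.Automorphic.ResGLnCohomology
import HarnessLib

/-!
# The coefficients `E_λ` of `Res_{F/ℚ} GL₂` inside a tensor power: Borel triangularity with characters

Topic `NumberTheory/Automorphic`; namespace `Literature.NumberTheory.Automorphic.ResWeight`.
Definitions with bodies and theorems (no named fact); `ParallelWeightTensorEmbedding` generalised
from parallel weight to an arbitrary weight `λ = (λ_τ)_τ` (one degree `d_τ` and one determinant
twist `m_τ` per embedding `τ : F →+* E`).

The representation `E_λ = ⨂_τ (S_{μ_τ}(E²) ⊗ det^{m_τ}) ∘ GL₂(τ)` of `GL₂(F)`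
(`ResGLnCohomology.coeffRep E 2 F lam`, `μ_τ = coeffPartition (lam τ) ⊢ d_τ = coeffDegree (lam τ)`,
`m_τ = lowestEntry (lam τ)`) embeds `GL₂(F)`-equivariantly (`coeffToAmbient`, injective and
equivariant) into the **ambient tensor representation** `𝕋 = ⨂_τ ((E²)^{⊗ d_τ} ⊗ det^{m_τ}) ∘ GL₂(τ)`
(`TensorAmbient`, `ambientRep`) with its standard basis `w_I`, `I : Π τ, (Fin d_τ → Fin 2)`
(`ambientBasis`) and matrix coefficients (`ambientBasis_repr_rho`)

  `⟨ρ(g) w_I, w_J⟩ = ∏_τ τ(det g)^{m_τ} · ∏_{τ, i} τ(g_{J τ i, I τ i})`.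

Hence the diagonal torus acts diagonally through the algebraic characters `χ_I`
(`ambientRep_basis_of_isDiag`) and — the new point — **every upper triangular `g` acts
triangularly with diagonal character `χ_I(g)`**: `ρ(g) w_I − χ_I(g) w_I` is a combination of the
`w_J` of smaller rank (`ambientRep_basis_sub_smul_mem_span_of_borel`); `χ_I` is multiplicative on
the Borel (`ambientChar_mul_of_borel`); `ambRank` is injective (`ambRank_eq_imp_eq`).  This is the input of the character dévissage
`Literature.Algebra.Homology.scalarFiltered_of_injective_hom_char` for the arithmetic subgroups
of the Borel with units [Harder1987, §2, (2.6)–(2.8)].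

## References

* G. Harder, *Eisenstein cohomology of arithmetic groups. The case GL₂*, Invent. Math. 89 (1987), §2.
  [Harder1987]
* W. Fulton, J. Harris, *Representation Theory*, GTM 129, §6.1, §15.5. [FultonHarrisGTM129]
-/

noncomputable section

open scoped TensorProduct
open Module Literature.NumberTheory.DiophantineGeometry Literature.NumberTheory.Automorphic.ParallelWeight

namespace Literature.NumberTheory.Automorphic.ResWeight

variable (E : Type) [Field E] (F : Type) [Field F] (d : (F →+* E) → ℕ) (m : (F →+* E) → ℤ)

/-! ### The ambient tensor representation -/

/-- **`𝕋 = ⨂_{τ : F → E} (E²)^{⊗ d_τ}`**, the ambient tensor space. [folklore] -/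
abbrev TensorAmbient : Type := ⨂[E] τ : (F →+* E), TensorPower E (d τ) (Fin 2 → E)

/-- The factor at `τ`: `((E²)^{⊗ d_τ} ⊗ det^{m_τ}) ∘ GL₂(τ)`. [folklore] -/
def ambientFactorRep (τ : F →+* E) : Representation E (GL (Fin 2) F) (TensorPower E (d τ) (Fin 2 → E)) :=
  (GLnCohomology.detTwist E (m τ) (glTensorRep (Fin 2) E (d τ))).comp (Matrix.GeneralLinearGroup.map τ)

/-- Unfolding `ambientFactorRep`. [folklore] -/
theorem ambientFactorRep_apply (τ : F →+* E) (g : GL (Fin 2) F) (v : TensorPower E (d τ) (Fin 2 → E)) :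
    ambientFactorRep E F d m τ g v =
      ((Matrix.GeneralLinearGroup.det (Matrix.GeneralLinearGroup.map τ g) ^ m τ : Eˣ) : E) •
        glTensorRep (Fin 2) E (d τ) (Matrix.GeneralLinearGroup.map τ g) v := rfl

/-- **The ambient representation `ρ_𝕋(g) = ⨂_τ (τ(det g)^{m_τ} · (τ g)^{⊗ d_τ})` of `GL₂(F)`.**
[cite: Harder1987, §2] -/
def ambientRep : Representation E (GL (Fin 2) F) (TensorAmbient E F d) :=
  PiTensorProduct.mapMonoidHom.comp (MonoidHom.pi fun τ : F →+* E => ambientFactorRep E F d m τ)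

/-- `ρ_𝕋(g)` on pure tensors. [folklore] -/
theorem ambientRep_apply_tprod (g : GL (Fin 2) F) (v : ∀ τ : F →+* E, TensorPower E (d τ) (Fin 2 → E)) :
    ambientRep E F d m g (PiTensorProduct.tprod E v) =
      PiTensorProduct.tprod E fun τ => ambientFactorRep E F d m τ g (v τ) :=
  PiTensorProduct.map_tprod _ _

/-! ### The standard basis and the matrix coefficients -/

section StdBasis

open scoped Classical

variable [NumberField F] [CharZero E]

/-- The index set of the standard basis of `𝕋`. [folklore] -/
abbrev AmbIdx : Type := ∀ τ : F →+* E, (Fin (d τ) → Fin 2)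

/-- **The standard basis `w_I = ⨂_τ ⨂_i e_{I τ i}` of `𝕋`.** [folklore] -/
def ambientBasis : Module.Basis (AmbIdx E F d) E (TensorAmbient E F d) :=
  Basis.piTensorProduct fun τ : F →+* E => innerBasis E (d τ)

/-- `ambientBasis` on an index. [folklore] -/
theorem ambientBasis_apply (I : AmbIdx E F d) :
    ambientBasis E F d I = PiTensorProduct.tprod E fun τ => innerBasis E (d τ) (I τ) := by
  rw [ambientBasis, Basis.piTensorProduct_apply]

/-- **The matrix coefficients of `ρ_𝕋(g)` in the standard basis**:
`⟨ρ_𝕋(g) w_I, w_J⟩ = ∏_τ τ(det g)^{m_τ} · ∏_{τ,i} τ(g_{J τ i, I τ i})`. [cite: Harder1987, §2] -/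
theorem ambientBasis_repr_rho (g : GL (Fin 2) F) (I J : AmbIdx E F d) :
    (ambientBasis E F d).repr (ambientRep E F d m g (ambientBasis E F d I)) J =
      (∏ τ : F →+* E, ((Matrix.GeneralLinearGroup.det (Matrix.GeneralLinearGroup.map τ g) ^ m τ : Eˣ) : E)) *
        ∏ τ : F →+* E, ∏ i : Fin (d τ), τ ((g : Matrix (Fin 2) (Fin 2) F) (J τ i) (I τ i)) := by
  rw [ambientBasis_apply, ambientRep_apply_tprod]
  simp_rw [ambientFactorRep_apply]
  rw [MultilinearMap.map_smul_univ, map_smul, Finsupp.smul_apply, smul_eq_mul, ambientBasis,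
    Basis.piTensorProduct_repr_tprod_apply]
  simp_rw [innerBasis_repr_glTensorRep]

/-- The character `χ_I(g) = ∏_τ τ(det g)^{m_τ} ∏_{τ,i} τ(g_{Iτi, Iτi})` of the Borel on `w_I`. [folklore] -/
def ambientChar (I : AmbIdx E F d) (g : GL (Fin 2) F) : E :=
  (∏ τ : F →+* E, ((Matrix.GeneralLinearGroup.det (Matrix.GeneralLinearGroup.map τ g) ^ m τ : Eˣ) : E)) *
    ∏ τ : F →+* E, ∏ i : Fin (d τ), τ ((g : Matrix (Fin 2) (Fin 2) F) (I τ i) (I τ i))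

/-- **`χ_I` is multiplicative on the upper triangular matrices.** [folklore] -/
theorem ambientChar_mul_of_borel (I : AmbIdx E F d) (g h : GL (Fin 2) F)
    (hg : (g : Matrix (Fin 2) (Fin 2) F) 1 0 = 0) (hh : (h : Matrix (Fin 2) (Fin 2) F) 1 0 = 0) :
    ambientChar E F d m I (g * h) = ambientChar E F d m I g * ambientChar E F d m I h := by
  have hdiag : ∀ a : Fin 2, ((g * h : GL (Fin 2) F) : Matrix (Fin 2) (Fin 2) F) a a =
      (g : Matrix (Fin 2) (Fin 2) F) a a * (h : Matrix (Fin 2) (Fin 2) F) a a := by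
    intro a
    rw [Matrix.GeneralLinearGroup.coe_mul, Matrix.mul_apply, Fin.sum_univ_two]
    fin_cases a
    · simp [hh]
    · simp [hg]
  unfold ambientChar
  simp_rw [hdiag, map_mul, mul_zpow, Units.val_mul, Finset.prod_mul_distrib]
  ring

/-- `χ_I(1) = 1`. [folklore] -/
theorem ambientChar_one (I : AmbIdx E F d) : ambientChar E F d m I 1 = 1 := by
  unfold ambientChar
  simp

/-- **Diagonal matrices act diagonally**: `ρ_𝕋(t) w_I = χ_I(t) w_I`. [cite: Harder1987, §2] -/
theorem ambientRep_basis_of_isDiag (g : GL (Fin 2) F)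
    (h01 : (g : Matrix (Fin 2) (Fin 2) F) 0 1 = 0) (h10 : (g : Matrix (Fin 2) (Fin 2) F) 1 0 = 0) (I : AmbIdx E F d) :
    ambientRep E F d m g (ambientBasis E F d I) = ambientChar E F d m I g • ambientBasis E F d I := by
  have hdiag : ∀ a b : Fin 2, a ≠ b → (g : Matrix (Fin 2) (Fin 2) F) a b = 0 := by
    intro a b hab
    fin_cases a <;> fin_cases b
    · exact absurd rfl hab
    · exact h01
    · exact h10
    · exact absurd rfl hab
  refine (ambientBasis E F d).ext_elem fun J => ?_
  rw [ambientBasis_repr_rho, map_smul, Finsupp.smul_apply, Module.Basis.repr_self, smul_eq_mul,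
    Finsupp.single_apply]
  by_cases hJ : I = J
  · subst hJ
    rw [if_pos rfl, mul_one]
    rfl
  · rw [if_neg hJ, mul_zero]
    obtain ⟨τ, hτ⟩ := Function.ne_iff.1 (Ne.symm hJ)
    obtain ⟨i, hi⟩ := Function.ne_iff.1 hτ
    refine mul_eq_zero_of_right _ (Finset.prod_eq_zero (Finset.mem_univ τ)
      (Finset.prod_eq_zero (Finset.mem_univ i) ?_))
    rw [hdiag _ _ hi, map_zero]

/-- The number of indices equal to `1`. [folklore] -/
def ones (I : AmbIdx E F d) : ℕ := ∑ τ : F →+* E, ∑ i : Fin (d τ), ((I τ i : Fin 2) : ℕ)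

/-- `J ≤ I` pointwise and `J ≠ I` forces `ones J < ones I`. [folklore] -/
theorem ones_lt_of_le_of_exists_ne {I J : AmbIdx E F d} (hle : ∀ τ i, J τ i ≤ I τ i)
    (hne : ∃ τ i, J τ i ≠ I τ i) : ones E F d J < ones E F d I := by
  obtain ⟨τ₀, i₀, hi⟩ := hne
  refine Finset.sum_lt_sum (fun τ _ => Finset.sum_le_sum fun i _ => Fin.val_fin_le.2 (hle τ i))
    ⟨τ₀, Finset.mem_univ _, Finset.sum_lt_sum (fun i _ => Fin.val_fin_le.2 (hle τ₀ i))
      ⟨i₀, Finset.mem_univ _, Fin.val_fin_lt.2 (lt_of_le_of_ne (hle τ₀ i₀) hi)⟩⟩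

/-- An injective refinement of `ones`. [folklore] -/
def ambRank (I : AmbIdx E F d) : ℕ :=
  ones E F d I * (Fintype.card (AmbIdx E F d) + 1) + (Fintype.equivFin (AmbIdx E F d) I : ℕ)

/-- `ambRank` is injective (its residue modulo `#indices + 1` is the enumeration). [folklore] -/
theorem ambRank_eq_imp_eq (I J : AmbIdx E F d) (h : ambRank E F d I = ambRank E F d J) : I = J := by
  have hmod : ∀ K : AmbIdx E F d,
      ambRank E F d K % (Fintype.card (AmbIdx E F d) + 1) = (Fintype.equivFin (AmbIdx E F d) K : ℕ) := by
    intro K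
    rw [ambRank, add_comm, Nat.add_mul_mod_self_right,
      Nat.mod_eq_of_lt (Nat.lt_succ_of_lt (Fintype.equivFin _ K).2)]
  have hI := hmod I
  rw [h, hmod] at hI
  exact (Fintype.equivFin (AmbIdx E F d)).injective (Fin.ext hI).symm

/-- Fewer ones means smaller rank. [folklore] -/
theorem ambRank_succ_le_of_ones_lt {I J : AmbIdx E F d} (h : ones E F d J < ones E F d I) :
    ambRank E F d J + 1 ≤ ambRank E F d I := by
  have hJ : (Fintype.equivFin (AmbIdx E F d) J : ℕ) < Fintype.card (AmbIdx E F d) + 1 :=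
    Nat.lt_succ_of_lt (Fintype.equivFin _ J).2
  unfold ambRank
  calc ones E F d J * (Fintype.card (AmbIdx E F d) + 1) + (Fintype.equivFin (AmbIdx E F d) J : ℕ) + 1
      ≤ ones E F d J * (Fintype.card (AmbIdx E F d) + 1) + (Fintype.card (AmbIdx E F d) + 1) := by omega
    _ = (ones E F d J + 1) * (Fintype.card (AmbIdx E F d) + 1) := by ring
    _ ≤ ones E F d I * (Fintype.card (AmbIdx E F d) + 1) := Nat.mul_le_mul_right _ h
    _ ≤ _ := Nat.le_add_right _ _

/-- **Upper triangular matrices act triangularly with diagonal character `χ_I`**: for `g = (a b; 0 e)`,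
`ρ_𝕋(g) w_I − χ_I(g) w_I` is a combination of the `w_J` with fewer ones (`rank J < rank I`).
[cite: Harder1987, §2, (2.6)] -/
theorem ambientRep_basis_sub_smul_mem_span_of_borel (g : GL (Fin 2) F)
    (h10 : (g : Matrix (Fin 2) (Fin 2) F) 1 0 = 0) (I : AmbIdx E F d) :
    ambientRep E F d m g (ambientBasis E F d I) - ambientChar E F d m I g • ambientBasis E F d I ∈
      Submodule.span E (ambientBasis E F d '' {J | ambRank E F d J < ambRank E F d I}) := by
  rw [Module.Basis.mem_span_image]
  intro J hJ
  rw [Finset.mem_coe, Finsupp.mem_support_iff, map_sub, map_smul, Finsupp.sub_apply, Finsupp.smul_apply,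
    Module.Basis.repr_self, ambientBasis_repr_rho, Finsupp.single_apply] at hJ
  change ambRank E F d J < ambRank E F d I
  by_cases hIJ : I = J
  · subst hIJ
    refine absurd ?_ hJ
    rw [if_pos rfl, smul_eq_mul, mul_one, sub_eq_zero]
    rfl
  · rw [if_neg hIJ, smul_zero, sub_zero] at hJ
    have hle : ∀ τ i, J τ i ≤ I τ i := by
      intro τ i
      by_contra hlt
      push Not at hlt
      have hv := Fin.lt_def.1 hlt
      have hJlt := (J τ i).isLt
      have hI0 : I τ i = 0 := Fin.ext (by simp only [Fin.val_zero]; omega)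
      have hJ1 : J τ i = 1 := Fin.ext (by simp only [Fin.val_one]; omega)
      refine hJ (mul_eq_zero_of_right _
        (Finset.prod_eq_zero (Finset.mem_univ τ) (Finset.prod_eq_zero (Finset.mem_univ i) ?_)))
      rw [hI0, hJ1, h10, map_zero]
    have hne : ∃ τ i, J τ i ≠ I τ i := by
      by_contra hall
      push Not at hall
      exact hIJ (funext fun τ => funext fun i => (hall τ i).symm)
    exact ambRank_succ_le_of_ones_lt E F d (ones_lt_of_le_of_exists_ne E F d hle hne)

end StdBasis

/-! ### The embedding of `E_λ` -/

section Embedding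

variable (lam : (F →+* E) → Fin 2 → ℤ)

/-- The degrees `d_τ = coeffDegree (λ_τ)`. [folklore] -/
abbrev deg : (F →+* E) → ℕ := fun τ => GLnCohomology.coeffDegree (lam τ)

/-- The twists `m_τ = lowestEntry (λ_τ)`. [folklore] -/
abbrev twist : (F →+* E) → ℤ := fun τ => GLnCohomology.lowestEntry (lam τ)

/-- **The embedding `E_λ ↪ 𝕋`**: the tensor product of the inclusions of the Weyl modules
`S_{μ_τ}(E²) ⊆ (E²)^{⊗ d_τ}`. [cite: FultonHarrisGTM129, §6.1] -/
def coeffToAmbient : ResGLnCohomology.CoeffModule E 2 F lam →ₗ[E] TensorAmbient E F (deg E F lam) :=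
  show (⨂[E] τ : (F →+* E), GLnCohomology.CoeffModule E 2 (lam τ)) →ₗ[E]
      (⨂[E] τ : (F →+* E), TensorPower E (GLnCohomology.coeffDegree (lam τ)) (Fin 2 → E)) from
    PiTensorProduct.map fun τ : F →+* E => coeffIncl E (lam τ)

/-- `coeffToAmbient` on pure tensors. [folklore] -/
theorem coeffToAmbient_tprod (v : ∀ τ : F →+* E, GLnCohomology.CoeffModule E 2 (lam τ)) :
    coeffToAmbient E F lam (PiTensorProduct.tprod E v) = PiTensorProduct.tprod E fun τ => coeffIncl E (lam τ) (v τ) :=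
  PiTensorProduct.map_tprod _ _

/-- **`E_λ ↪ 𝕋` is injective** (each inclusion of a Weyl module is split). [folklore] -/
theorem coeffToAmbient_injective : Function.Injective (coeffToAmbient E F lam) := by
  have hr : ∀ τ : F →+* E, ∃ r : TensorPower E (GLnCohomology.coeffDegree (lam τ)) (Fin 2 → E) →ₗ[E]
      GLnCohomology.CoeffModule E 2 (lam τ), r ∘ₗ coeffIncl E (lam τ) = LinearMap.id := fun τ =>
    (coeffIncl E (lam τ)).exists_leftInverse_of_injective (LinearMap.ker_eq_bot.2 (coeffIncl_injective E (lam τ)))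
  choose r hr using hr
  have hcomp : (PiTensorProduct.map r) ∘ₗ coeffToAmbient E F lam = LinearMap.id := by
    change (PiTensorProduct.map r) ∘ₗ (PiTensorProduct.map fun τ : F →+* E => coeffIncl E (lam τ)) = LinearMap.id
    rw [← PiTensorProduct.map_comp]
    simp_rw [hr]
    exact PiTensorProduct.map_id
  intro a b hab
  have := congrArg (PiTensorProduct.map r) hab
  change ((PiTensorProduct.map r) ∘ₗ coeffToAmbient E F lam) a = ((PiTensorProduct.map r) ∘ₗ coeffToAmbient E F lam) b
    at this
  rwa [hcomp] at this

/-- **`E_λ ↪ 𝕋` is `GL₂(F)`-equivariant.** [cite: Harder1987, §2] -/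
theorem coeffToAmbient_coeffRep (g : GL (Fin 2) F) (v : ResGLnCohomology.CoeffModule E 2 F lam) :
    coeffToAmbient E F lam (ResGLnCohomology.coeffRep E 2 F lam g v) =
      ambientRep E F (deg E F lam) (twist E F lam) g (coeffToAmbient E F lam v) := by
  have h1 : (coeffToAmbient E F lam) ∘ₗ
      (ResGLnCohomology.coeffRep E 2 F lam g : ResGLnCohomology.CoeffModule E 2 F lam →ₗ[E] _) =
      (ambientRep E F (deg E F lam) (twist E F lam) g : _ →ₗ[E] _) ∘ₗ coeffToAmbient E F lam := by
    change (PiTensorProduct.map fun τ : F →+* E => coeffIncl E (lam τ)) ∘ₗ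
        (PiTensorProduct.map fun τ : F →+* E =>
          (GLnCohomology.coeffRepGL E 2 (lam τ) (Matrix.GeneralLinearGroup.map τ g) : _ →ₗ[E] _)) =
      (PiTensorProduct.map fun τ : F →+* E =>
          (ambientFactorRep E F (deg E F lam) (twist E F lam) τ g : _ →ₗ[E] _)) ∘ₗ
        (PiTensorProduct.map fun τ : F →+* E => coeffIncl E (lam τ))
    rw [← PiTensorProduct.map_comp, ← PiTensorProduct.map_comp]
    congr 1
  exact LinearMap.congr_fun h1 v

/-- The image of `E_λ` lies in the span of the standard basis (trivially: the basis spans). [folklore] -/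
theorem range_coeffToAmbient_le [NumberField F] [CharZero E] :
    LinearMap.range (coeffToAmbient E F lam) ≤ Submodule.span E (Set.range (ambientBasis E F (deg E F lam))) := by
  classical
  rw [(ambientBasis E F (deg E F lam)).span_eq]
  exact le_top

end Embedding

end Literature.NumberTheory.Automorphic.ResWeight
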